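import Summits.QuantumFields.YangMills.Theorems.BalabanUVNodesN07ShearSizeTopBox
import Summits.QuantumFields.YangMills.Theorems.BalabanUVNodesN07DataAxialTopBox

/-!
# DAG node N07 [B11] — road R0′ rows (r1)+(r4) AT THE RECORD with the data letter `v` SUPPLIED by module 40: when the level-`j` data on the box is the AXIALLY RE-GAUGED datum `V^h` of
# dag-n07-e's `…N07DataAxialTopBox` ((147) ∕ (160) case I), its bond size is `v := (d − 1)·n·δ` (`dist1_dataAxial_le`), so the composed row of `…N07ShearSizeTopBox` reads with only the
# Landau copy's letter `a` displayed — def-free sequel of this seat's p613291 ∕ p613938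

Cell `pub-ymgap` (HUMAN RULINGS D-0062 ∕ D-0088 ∕ D-0149), width seat `pub-ymgap-dag-n07-w6` g0 (second wave), 2026-08-28; CLAIM-4 (r4-rec) scope, lane owner dag-n07-e g20's words (cell bus 06:38Z (D) «`v` from
(151)∕module 40»; 07:00Z «(r4-rec) consumer … datum `V` DISPLAYED on the window's bonds»).  `--kind proof --supports stmt-QuantumFields-20542 --as helper` (K1⁷; count-neutral).  THEOREMS ONLY.

THE PRINT.  [B11] = [Balaban1985Variational] p. 301 (147) (the data re-gauged by the axial gauge of the top cube, centre `y`) and (151) «|V″ − 1| < 9dL²Mε₀ ≤ c₀ on 𝔅_k»; p. 303 (160) first case «|V′₁(x, x′) − 1| <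
|x − y|2L²ε₁»; (152)–(156) pp. 301–302.

WHAT THIS FILE DOES (one composition BY NAME; nothing of [B11] analysis asserted).  ★★ `norm_mlog_iter_avOfRecord_centred_sub_le_dataAxial`: in the setting of `N07ShearSizeTopBox.norm_mlog_iter_avOfRecord_centred_sub_le`
(averaging of record, torus `K`, level `j ≤ m + K`, box `[lo, hi]` of `T^{(j)}` with `hi ≤ lo + n`, NON-WRAPPING `n + 1 < N_j`), if the level-`j` data of the axial representative on the box bonds IS module 40's re-gauged datum —
`M^j(U₁^u)(c) = (V^{h})(c)` with `h := axialGauge V lo hi` (pv26) for a level-`j` configuration `V` whose plaquettes based in the box are `δ`-small (`PlaqSmallOn S₀ δ V`, `boxPlaqs lo hi ⊆ S₀`) — then the data letter is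
`v := (d − 1)·n·δ` (module 40 `dist1_dataAxial_le` through this seat's door `mem_boxBonds_of_ends_mem_box`), and the composed row holds with `σ♮ := D·((d−1)nδ + a)`: only `a` (the Landau copy's averages,
(152) ∕ dag-n07-w2's weighted ball) stays displayed.  `dist1_data_le_of_dataAxial` is the bond-letter lemma alone.

HONEST FRAMING (binding).  Count-neutral helper; by-name composition of p613291∕p613938 (this seat) and p606565 (dag-n07-e module 40); the data identity `hdata`, `a`, the axial gauges and the smallness thresholds are
HYPOTHESES; nothing of [B11]∕[6]∕[3] analysis asserted; BRIDGE-92-B stays GAP-STATED until the S6 head knits (r0)–(r4); tokens ∕ stub 1 ∕ K0⁷ ∕ K1⁷ NOT closed; N07 NOT discharged (typed 28∕28 · discharged 5∕27 unmoved);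
no summit statement is proved by this seat; one finite `T⁴` programme at fixed `ε`, Bałaban AS PRINTED — the route closes the conditional finite-𝕋⁴ rung `BalabanLadder.UV` only; NOT continuum ∕ ℝ⁴ ∕ OS ∕ mass gap ∕ Clay.
No `sorry`, no `def`, no `instance`, no `notation`.
-/

noncomputable section

namespace Summit.QuantumFields.YangMills.BalabanUVNodes.N07ShearSizeTopBoxDataAxial

open scoped Matrix.Norms.L2Operator
open Literature.MathematicalPhysics.QuantumFieldTheory.Balaban1983to89
open Literature.MathematicalPhysics.QuantumFieldTheory.Balaban1983to89.Node00
open T4AxialGaugeSmallField (castSite axialGauge boxPlaqs boxBonds)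
open B16Sect1Backgrounds (toMS)
open GaugeField (gaugeAct)
open MatrixLog (mlog)
open Summit.QuantumFields.YangMills.BalabanUVNodes.N07ShearSizeTopBox (mem_boxBonds_of_ends_mem_box norm_mlog_iter_avOfRecord_centred_sub_le)
open Summit.QuantumFields.YangMills.BalabanUVNodes.N07DataAxialTopBox (dist1_dataAxial_le)

variable (F : T4Continuum.T4Family) (N : ℕ) [NeZero N]

/-- **The data letter `v` from module 40**: if on the bonds of the box the level-`j` data of the axial representative IS the axially re-gauged datum `V^h`, `h = axialGauge V lo hi`, of a configuration `V`
with `δ`-small box plaquettes, then `dist1 M^j(U₁^u)(c) ≤ (d − 1)·n·δ` on every bond with both ends in the box (`hi ≤ lo + n`, non-wrapping `n + 1 < N_j`).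
[cite: Balaban1985Variational, (147) p.301, (160) p.303] -/
theorem dist1_data_le_of_dataAxial (K : ℕ) (u : GaugeTransf (F.P K) 0 (SU N)) (U₁ : GaugeField (F.P K) 0 (SU N)) {j : ℕ}
    {lo hi : Fin (F.P K).d → ℤ} {n : ℕ} (hn : ∀ κ, hi κ ≤ lo κ + n) (hnN : n + 1 < (F.P K).sitesPerDir j)
    (V : GaugeField (F.P K) j (SU N)) {δ : ℝ} {S₀ : Set (Plaq (F.P K) j)} (hS₀ : boxPlaqs lo hi ⊆ S₀) (hV : PlaqSmallOn S₀ δ V) (hδ : 0 ≤ δ)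
    (hdata : ∀ c : PBond (F.P K) j, c.src ∈ (castSite '' Set.Icc lo hi : Set (Site (F.P K) j)) → c.tgt ∈ (castSite '' Set.Icc lo hi : Set (Site (F.P K) j)) →
      Averaging.iter (avOfRecord F N K) j (gaugeAct u U₁) c = gaugeAct (axialGauge V lo hi) V c)
    {c : PBond (F.P K) j} (hs : c.src ∈ (castSite '' Set.Icc lo hi : Set (Site (F.P K) j))) (ht : c.tgt ∈ (castSite '' Set.Icc lo hi : Set (Site (F.P K) j))) :
    dist1 (Averaging.iter (avOfRecord F N K) j (gaugeAct u U₁) c) ≤ (((F.P K).d - 1 : ℕ) : ℝ) * n * δ := by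
  rw [hdata c hs ht]
  have hN : ∀ κ, hi κ + 1 - lo κ < (F.P K).sitesPerDir j := fun κ => by have := hn κ; omega
  have hnN' : n < (F.P K).sitesPerDir j := by omega
  exact dist1_dataAxial_le V hS₀ hV hδ hn hnN' (mem_boxBonds_of_ends_mem_box hN hs ht)

/-- ★★ **ROWS (r1)+(r4) AT THE RECORD WITH `v := (d − 1)·n·δ` SUPPLIED**: in the setting of `N07ShearSizeTopBox.norm_mlog_iter_avOfRecord_centred_sub_le`, when the box data is module 40's re-gauged datum (`hdata`),
the composed row holds with `v := (d−1)nδ` and `σ♮ := D·((d−1)nδ + a)`, `D = Σ_κ(hi_κ − lo_κ)`: on every box bond `c`,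
`‖log M^j(U₁)(c) − (log V♮(c) + (log ĝ(c₋)⁻¹ − log ĝ(c₊)⁻¹))‖ ≤ 8σ♮² + 20σ♮·(d−1)nδ` — only the Landau copy's letter `a` stays displayed. [cite: Balaban1985Variational, (151)–(156) pp.301–302, (160) p.303] -/
theorem norm_mlog_iter_avOfRecord_centred_sub_le_dataAxial (K : ℕ) (u : GaugeTransf (F.P K) 0 (SU N)) (U₁ : GaugeField (F.P K) 0 (SU N)) {j : ℕ}
    (hj : j ≤ (F.P K).m + (F.P K).K) {lo hi : Fin (F.P K).d → ℤ} {n : ℕ} (hn : ∀ κ, hi κ ≤ lo κ + n) (hnN : n + 1 < (F.P K).sitesPerDir j)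
    (V : GaugeField (F.P K) j (SU N)) {δ : ℝ} {S₀ : Set (Plaq (F.P K) j)} (hS₀ : boxPlaqs lo hi ⊆ S₀) (hV : PlaqSmallOn S₀ δ V) (hδ : 0 ≤ δ)
    (hdata : ∀ c : PBond (F.P K) j, c.src ∈ (castSite '' Set.Icc lo hi : Set (Site (F.P K) j)) → c.tgt ∈ (castSite '' Set.Icc lo hi : Set (Site (F.P K) j)) →
      Averaging.iter (avOfRecord F N K) j (gaugeAct u U₁) c = gaugeAct (axialGauge V lo hi) V c)
    {a : ℝ} (ha0 : 0 ≤ a)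
    (ha : ∀ c : PBond (F.P K) j, c.src ∈ (castSite '' Set.Icc lo hi : Set (Site (F.P K) j)) → c.tgt ∈ (castSite '' Set.Icc lo hi : Set (Site (F.P K) j)) →
      dist1 (Averaging.iter (avOfRecord F N K) j U₁ c) ≤ a)
    (hσ : ((∑ κ, (hi κ - lo κ).toNat : ℕ) : ℝ) * ((((F.P K).d - 1 : ℕ) : ℝ) * n * δ + a) ≤ 1 / 80) (hv40 : (((F.P K).d - 1 : ℕ) : ℝ) * n * δ ≤ 1 / 40)
    {c : PBond (F.P K) j} (hs : c.src ∈ (castSite '' Set.Icc lo hi : Set (Site (F.P K) j))) (ht : c.tgt ∈ (castSite '' Set.Icc lo hi : Set (Site (F.P K) j))) :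
    ‖mlog ((Averaging.iter (avOfRecord F N K) j U₁ c : SU N) : MatA N) -
        (mlog ((((toMS u j (castSite lo))⁻¹ * Averaging.iter (avOfRecord F N K) j (gaugeAct u U₁) c * toMS u j (castSite lo) : SU N)) : MatA N) +
          (mlog (((((toMS u j (castSite lo))⁻¹ * toMS u j c.src)⁻¹ : SU N)) : MatA N) -
            mlog (((((toMS u j (castSite lo))⁻¹ * toMS u j c.tgt)⁻¹ : SU N)) : MatA N)))‖ ≤
      8 * (((∑ κ, (hi κ - lo κ).toNat : ℕ) : ℝ) * ((((F.P K).d - 1 : ℕ) : ℝ) * n * δ + a)) ^ 2 +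
        20 * (((∑ κ, (hi κ - lo κ).toNat : ℕ) : ℝ) * ((((F.P K).d - 1 : ℕ) : ℝ) * n * δ + a)) * ((((F.P K).d - 1 : ℕ) : ℝ) * n * δ) := by
  have hv0 : 0 ≤ (((F.P K).d - 1 : ℕ) : ℝ) * n * δ := by positivity
  exact norm_mlog_iter_avOfRecord_centred_sub_le F N K u U₁ hj hv0 ha0
    (fun c hs ht => dist1_data_le_of_dataAxial F N K u U₁ hn hnN V hS₀ hV hδ hdata hs ht) ha hσ hv40 hs ht

end Summit.QuantumFields.YangMills.BalabanUVNodes.N07ShearSizeTopBoxDataAxial
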